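import Mathlib
import Summits.Ventures.HodgeRepro2.Tier7.Line3.DiscreteSubgroupCount
import Summits.Ventures.HodgeRepro2.Tier7.Line3.NumberFieldHyperbolicCount

/-!
# Tier 7 — LINE 3 support: the count of a discrete subgroup of `SL(2, ℝ) × SL(2, ℝ)` — the two `(1,1)`-places jointly
(`Line3/DiscreteProductCount.lean`; t7-L1-p1, gen 3; Mathlib + Line3/DiscreteSubgroupCount (+ Packing, HyperbolicSize,
PoincareKernel) + p5's Line3/NumberFieldHyperbolicCount (its dyadic lemmas `two_pow_log_floor_le`, `le_two_pow_log_floor_succ`))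

WHY A PRODUCT. The arithmetic subgroups of the line's `U(W_A)(F)` (`F = E′⁺` totally real of degree `≥ 2`) are IRREDUCIBLE
lattices in `U(W_A)(F_∞) = U(2) × U(1,1) × U(1,1)`: their projection to ONE non-compact factor is dense, not discrete (the
Hilbert-modular phenomenon), so `DiscreteSubgroupCount.count_of_discrete` models the real lattice only when `F = ℚ`. The
model of the real lattice at the two `(1,1)`-places is a DISCRETE subgroup `Γ ≤ SL(2, ℝ) × SL(2, ℝ)` (the compact `U(2)`
contributes a finite multiplicity; `U(1,1) = U(1)·SU(1,1)`, `SU(1,1) ≅ SL(2, ℝ)`: the dictionary). For every such `Γ` with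
`1` isolated entrywise in both components (`IsolatedOne₂ Γ ε₀`), `ε = min (1/8) (ε₀/8)`:
* BOX COUNT `#{γ ∈ Γ : κ γ.1 ≤ R₂ ∧ κ γ.2 ≤ R₃} ≤ (512/ε³)² R₂ R₃` (`card_le_box`): packing in `E × E = ℝ⁴ × ℝ⁴`, the
  translates `γ (B × B)` pairwise disjoint (`disjoint_image_actE₂`, `inv_close` in each component) inside `W R₂ ε ×ˢ W R₃ ε`
  (`card_mul_volume_le₂`);
* PRODUCT SIZE `psize g := (1 + κ g.1)(1 + κ g.2) − 1`: `#{psize γ ≤ R} ≤ 2 (512/ε³)² (1 + R)(1 + log₂ (1 + R))`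
  (`card_le_psize`, dyadic slices in `κ γ.1`, p5's device for group elements), hence the `hcount` shape with `β = 1 + ε'`
  for every `ε' > 0` (`count_psize_rpow`); the multiplicative shift with `M₂ x := 8 κ x.1 κ x.2` (`psize_shift`);
* so `PoincareKernel.summable_norm_shift_of_mul` / `continuous_kernelSum_of_mul` apply: for `‖f g‖ ≤ C (1 + psize g)^(−α)`,
  `α > 1`, the Poincaré series `Σ_{γ ∈ Γ} f (x⁻¹ γ y)` converges absolutely and is continuous on `SL(2,ℝ)² × SL(2,ℝ)²`
  (`summable_norm_kernel_product`, `continuous_kernelSum_product`); the line's test function at the two `(1,1)`-places,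
  a PRODUCT `f₂ (g.1) · f₃ (g.2)` of coefficients with the decay `(1 + κ)^(−α)` each (p1's rows 673/677 at `γh`, `α = k/2`;
  weight `3`: `α = 3/2 > 1 + ε'`), has exactly this decay (`norm_prod_le`; `continuous_kernelSum_product_two`).
The real lattice's discreteness in the archimedean product, the compact-factor multiplicity and `U(1,1) = U(1)·SU(1,1)`
stay the dictionary (TYPING-CENSUS T7); nothing about (N) or (P). Sorry-free; axioms: propext / Classical.choice /
Quot.sound. §8(d): uses an L-value-free non-vanishing device: NO.
-/

namespace Summit.Ventures.HodgeRepro2.Tier7.Line3.DiscreteProductCount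

open MeasureTheory Metric Matrix Summit.Ventures.HodgeRepro2.Tier7.Line3.HyperbolicSize
  Summit.Ventures.HodgeRepro2.Tier7.Line3.DiscreteSubgroupPacking
  Summit.Ventures.HodgeRepro2.Tier7.Line3.DiscreteSubgroupCount
open scoped MatrixGroups

noncomputable section
/-! ## 1. The product group, the joint isolation hypothesis, the product action -/

/-- the product of the two `(1,1)`-place groups -/
abbrev G₂ := SL(2, ℝ) × SL(2, ℝ)

/-- `1` is isolated in `Γ ≤ SL(2,ℝ)²` at scale `ε₀`, entrywise in BOTH components -/
def IsolatedOne₂ (Γ : Subgroup G₂) (ε₀ : ℝ) : Prop :=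
  ∀ γ ∈ Γ, (∀ i j, |(γ.1 : Matrix (Fin 2) (Fin 2) ℝ) i j - (1 : Matrix (Fin 2) (Fin 2) ℝ) i j| < ε₀) →
    (∀ i j, |(γ.2 : Matrix (Fin 2) (Fin 2) ℝ) i j - (1 : Matrix (Fin 2) (Fin 2) ℝ) i j| < ε₀) → γ = 1

/-- the entries of `γ'⁻¹ γ` are within `6 ε` of the identity when `actE γ z = actE γ' z'` with `z, z' ∈ ball z₁ ε`
(the core of `DiscreteSubgroupCount.disjoint_image_actE`, restated for one component) -/
theorem entries_close_of_actE_eq {ε : ℝ} (hε : ε ≤ 1 / 8) {γ γ' : SL(2, ℝ)} {z z' : E}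
    (hz : z ∈ ball z₁ ε) (hz' : z' ∈ ball z₁ ε) (h : actE γ z = actE γ' z') :
    ∀ i j, |((γ'⁻¹ * γ : SL(2, ℝ)) : Matrix (Fin 2) (Fin 2) ℝ) i j - (1 : Matrix (Fin 2) (Fin 2) ℝ) i j| < 6 * ε := by
  have hz'' : actE (γ'⁻¹ * γ) z = z' := by rw [← actE_mul, h, actE_inv_actE]
  have hY : (γ'⁻¹ * γ : SL(2, ℝ)) * mat (Ψ z) = mat (Ψ z') := by
    rw [← mat_actF, ← Ψ_actE, hz'']
  obtain ⟨ha, hb, hc, hd⟩ := entries_close hz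
  obtain ⟨ha', hb', hc', hd'⟩ := entries_close hz'
  obtain ⟨h1, h2, h3, h4⟩ := entries_mul_eq hY
  obtain ⟨hx, hy, hu, hv⟩ := inv_close hε ha hb hc hd ha' hb' hc' hd' h1 h2 h3 h4
  intro i j
  fin_cases i <;> fin_cases j
  · simpa using hx
  · simpa using hy
  · simpa using hu
  · simpa using hv

/-- the product action on `E × E` -/
def actE₂ (γ : G₂) : E × E → E × E := Prod.map (actE γ.1) (actE γ.2)

/-- the image of a product set is the product of the images -/
theorem image_actE₂_prod (γ : G₂) (s t : Set E) :
    actE₂ γ '' (s ×ˢ t) = (actE γ.1 '' s) ×ˢ (actE γ.2 '' t) :=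
  Set.prodMap_image_prod _ _ _ _

/-- the product action preserves the volume of product sets -/
theorem volume_image_actE₂ (γ : G₂) (s t : Set E) :
    volume (actE₂ γ '' (s ×ˢ t)) = volume s * volume t := by
  rw [image_actE₂_prod, Measure.volume_eq_prod, Measure.prod_prod, volume_image_actE, volume_image_actE]

/-! ## 2. Packing in `E × E`: disjoint translates inside the product slab -/

/-- DISJOINTNESS of the translates `γ (B × B)`, `γ' (B × B)` for `γ ≠ γ'` in `Γ` -/
theorem disjoint_image_actE₂ {Γ : Subgroup G₂} {ε₀ : ℝ} (hdisc : IsolatedOne₂ Γ ε₀) {ε : ℝ}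
    (hε : ε ≤ 1 / 8) (h6 : 6 * ε ≤ ε₀) {γ γ' : G₂} (hγ : γ ∈ Γ) (hγ' : γ' ∈ Γ) (hne : γ ≠ γ') :
    Disjoint (actE₂ γ '' (ball z₁ ε ×ˢ ball z₁ ε)) (actE₂ γ' '' (ball z₁ ε ×ˢ ball z₁ ε)) := by
  rw [image_actE₂_prod, image_actE₂_prod, Set.disjoint_left]
  rintro ⟨w₁, w₂⟩ ⟨⟨u₁, hu₁, hw₁⟩, ⟨u₂, hu₂, hw₂⟩⟩ ⟨⟨v₁, hv₁, hw₁'⟩, ⟨v₂, hv₂, hw₂'⟩⟩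
  apply hne
  have h1 := entries_close_of_actE_eq hε hu₁ hv₁ (hw₁.trans hw₁'.symm)
  have h2 := entries_close_of_actE_eq hε hu₂ hv₂ (hw₂.trans hw₂'.symm)
  have hmem : γ'⁻¹ * γ ∈ Γ := Γ.mul_mem (Γ.inv_mem hγ') hγ
  have hδ : γ'⁻¹ * γ = 1 :=
    hdisc _ hmem (fun i j => lt_of_lt_of_le (h1 i j) h6) (fun i j => lt_of_lt_of_le (h2 i j) h6)
  exact (inv_mul_eq_one.mp hδ).symm

/-- `#t · (volume B)² ≤ volume (W R₂ ε) · volume (W R₃ ε)` for a finite `t` of elements with `κ γ.1 ≤ R₂`, `κ γ.2 ≤ R₃` -/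
theorem card_mul_volume_le₂ {Γ : Subgroup G₂} {ε₀ : ℝ} (hdisc : IsolatedOne₂ Γ ε₀) {ε : ℝ}
    (hε : ε ≤ 1 / 8) (h6 : 6 * ε ≤ ε₀) {R₂ R₃ : ℝ} (t : Finset Γ)
    (ht : ∀ γ ∈ t, κ (γ : G₂).1 ≤ R₂ ∧ κ (γ : G₂).2 ≤ R₃) :
    (t.card : ENNReal) * (volume (ball z₁ ε) * volume (ball z₁ ε)) ≤ volume (W R₂ ε) * volume (W R₃ ε) := by
  have hdisj : (↑t : Set Γ).PairwiseDisjoint fun γ : Γ => actE₂ (γ : G₂) '' (ball z₁ ε ×ˢ ball z₁ ε) := by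
    intro γ _ γ' _ hne
    exact disjoint_image_actE₂ hdisc hε h6 γ.2 γ'.2 fun h => hne (Subtype.ext h)
  have hmeas : ∀ γ ∈ t, MeasurableSet (actE₂ (γ : G₂) '' (ball z₁ ε ×ˢ ball z₁ ε)) := fun γ _ => by
    rw [image_actE₂_prod]
    exact (measurableSet_image_actE _ measurableSet_ball).prod (measurableSet_image_actE _ measurableSet_ball)
  calc (t.card : ENNReal) * (volume (ball z₁ ε) * volume (ball z₁ ε))
      = ∑ γ ∈ t, volume (actE₂ (γ : G₂) '' (ball z₁ ε ×ˢ ball z₁ ε)) := by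
        simp only [volume_image_actE₂]
        rw [Finset.sum_const, nsmul_eq_mul]
    _ = volume (⋃ γ ∈ t, actE₂ (γ : G₂) '' (ball z₁ ε ×ˢ ball z₁ ε)) :=
        (measure_biUnion_finset hdisj hmeas).symm
    _ ≤ volume (W R₂ ε ×ˢ W R₃ ε) := by
        apply measure_mono
        apply Set.iUnion₂_subset
        intro γ hγ
        rw [image_actE₂_prod]
        exact Set.prod_mono (image_actE_subset_W hε (ht γ hγ).1) (image_actE_subset_W hε (ht γ hγ).2)
    _ = volume (W R₂ ε) * volume (W R₃ ε) := by rw [Measure.volume_eq_prod, Measure.prod_prod]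

/-- THE BOX COUNT: `#t ≤ (512 R₂ / ε³)(512 R₃ / ε³)` for every finite `t ⊆ {γ ∈ Γ : κ γ.1 ≤ R₂ ∧ κ γ.2 ≤ R₃}` -/
theorem card_le_box {Γ : Subgroup G₂} {ε₀ : ℝ} (hdisc : IsolatedOne₂ Γ ε₀) {ε : ℝ} (hε0 : 0 < ε)
    (hε : ε ≤ 1 / 8) (h6 : 6 * ε ≤ ε₀) {R₂ R₃ : ℝ} (hR₂ : 0 ≤ R₂) (hR₃ : 0 ≤ R₃) (t : Finset Γ)
    (ht : ∀ γ ∈ t, κ (γ : G₂).1 ≤ R₂ ∧ κ (γ : G₂).2 ≤ R₃) :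
    (t.card : ℝ) ≤ (512 * R₂ / ε ^ 3) * (512 * R₃ / ε ^ 3) := by
  have h := card_mul_volume_le₂ hdisc hε h6 t ht
  have h2 := volume_W_le ε hR₂
  have h3 := volume_W_le ε hR₃
  rw [volume_ball_z₁ hε0.le] at h
  have h4 := h.trans (mul_le_mul' h2 h3)
  have h5 : (t.card : ENNReal) * (ENNReal.ofReal (ε ^ 2) * ENNReal.ofReal (ε ^ 2) *
      (ENNReal.ofReal (ε ^ 2) * ENNReal.ofReal (ε ^ 2))) ≤
      ENNReal.ofReal (32 * ε) * ENNReal.ofReal (16 * R₂) * (ENNReal.ofReal (32 * ε) * ENNReal.ofReal (16 * R₃)) := by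
    have hc : c₂ * c₂ * (c₂ * c₂) ≠ 0 := by
      have := c₂_pos.ne'
      positivity
    have hc' : c₂ * c₂ * (c₂ * c₂) ≠ ⊤ :=
      ENNReal.mul_ne_top (ENNReal.mul_ne_top c₂_ne_top c₂_ne_top) (ENNReal.mul_ne_top c₂_ne_top c₂_ne_top)
    rw [← ENNReal.mul_le_mul_iff_right hc hc']
    calc c₂ * c₂ * (c₂ * c₂) * ((t.card : ENNReal) * (ENNReal.ofReal (ε ^ 2) * ENNReal.ofReal (ε ^ 2) *
          (ENNReal.ofReal (ε ^ 2) * ENNReal.ofReal (ε ^ 2))))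
        = (t.card : ENNReal) * (ENNReal.ofReal (ε ^ 2) * c₂ * (ENNReal.ofReal (ε ^ 2) * c₂) *
          (ENNReal.ofReal (ε ^ 2) * c₂ * (ENNReal.ofReal (ε ^ 2) * c₂))) := by ring
      _ ≤ ENNReal.ofReal (32 * ε) * c₂ * (ENNReal.ofReal (16 * R₂) * c₂) *
          (ENNReal.ofReal (32 * ε) * c₂ * (ENNReal.ofReal (16 * R₃) * c₂)) := h4
      _ = c₂ * c₂ * (c₂ * c₂) * (ENNReal.ofReal (32 * ε) * ENNReal.ofReal (16 * R₂) *
          (ENNReal.ofReal (32 * ε) * ENNReal.ofReal (16 * R₃))) := by ring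
  rw [← ENNReal.ofReal_natCast] at h5
  repeat rw [← ENNReal.ofReal_mul (by positivity)] at h5
  rw [ENNReal.ofReal_le_ofReal_iff (by positivity)] at h5
  have hε3 : 0 < ε ^ 3 := by positivity
  rw [div_mul_div_comm, le_div_iff₀ (by positivity)]
  have h6' : ε ^ 2 * ((t.card : ℝ) * (ε ^ 3 * ε ^ 3)) ≤ ε ^ 2 * (512 * R₂ * (512 * R₃)) := by nlinarith [h5]
  exact le_of_mul_le_mul_left h6' (by positivity)

/-- FINITENESS of the box `{γ ∈ Γ : κ γ.1 ≤ R₂ ∧ κ γ.2 ≤ R₃}` -/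
theorem finite_box {Γ : Subgroup G₂} {ε₀ : ℝ} (hdisc : IsolatedOne₂ Γ ε₀) {ε : ℝ} (hε0 : 0 < ε)
    (hε : ε ≤ 1 / 8) (h6 : 6 * ε ≤ ε₀) {R₂ R₃ : ℝ} (hR₂ : 0 ≤ R₂) (hR₃ : 0 ≤ R₃) :
    {γ : Γ | κ (γ : G₂).1 ≤ R₂ ∧ κ (γ : G₂).2 ≤ R₃}.Finite := by
  by_contra hinf
  obtain ⟨t, hts, hcard⟩ := Set.Infinite.exists_subset_card_eq hinf
    (⌊(512 * R₂ / ε ^ 3) * (512 * R₃ / ε ^ 3)⌋₊ + 1)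
  have h := card_le_box hdisc hε0 hε h6 hR₂ hR₃ t fun γ hγ => hts hγ
  rw [hcard] at h
  have h2 := Nat.lt_floor_add_one ((512 * R₂ / ε ^ 3) * (512 * R₃ / ε ^ 3))
  push_cast at h
  linarith

/-! ## 3. The product size and its dyadic count -/

/-- the product size `(1 + κ g.1)(1 + κ g.2) − 1` (so that `1 + psize g` is the product of the two `1 + κ`) -/
def psize (g : G₂) : ℝ := (1 + κ g.1) * (1 + κ g.2) - 1

/-- `1 + psize g = (1 + κ g.1)(1 + κ g.2)` -/
theorem one_add_psize (g : G₂) : 1 + psize g = (1 + κ g.1) * (1 + κ g.2) := by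
  simp [psize]

/-- `psize ≥ 3 ≥ 0` -/
theorem psize_nonneg (g : G₂) : 0 ≤ psize g := by
  have h1 := one_le_κ g.1
  have h2 := one_le_κ g.2
  simp only [psize]
  nlinarith

/-- the shift constant `M x := 8 κ x.1 κ x.2` -/
def M₂ (x : G₂) : ℝ := 8 * κ x.1 * κ x.2

/-- `M₂ ≥ 0` -/
theorem M₂_nonneg (x : G₂) : 0 ≤ M₂ x := by
  have := κ_nonneg x.1; have := κ_nonneg x.2
  simp only [M₂]; positivity

/-- `M₂` is continuous -/
theorem continuous_M₂ : Continuous M₂ :=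
  (continuous_const.mul (κ_continuous.comp continuous_fst)).mul (κ_continuous.comp continuous_snd)

/-- `M₂` is locally bounded -/
theorem M₂_locBdd (x₀ : G₂) : ∃ U ∈ nhds x₀, ∃ c : ℝ, ∀ x ∈ U, M₂ x ≤ c :=
  PoincareKernel.size_locBdd_of_continuous M₂ continuous_M₂ x₀

/-- THE MULTIPLICATIVE SHIFT of the product size: `1 + psize g ≤ M₂ x · M₂ y · (1 + psize (x⁻¹ g y))` -/
theorem psize_shift (x g y : G₂) : 1 + psize g ≤ M₂ x * M₂ y * (1 + psize (x⁻¹ * g * y)) := by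
  rw [one_add_psize, one_add_psize]
  have h1 := one_add_κ_le x.1 g.1 y.1
  have h2 := one_add_κ_le x.2 g.2 y.2
  have e1 : (x⁻¹ * g * y).1 = x.1⁻¹ * g.1 * y.1 := rfl
  have e2 : (x⁻¹ * g * y).2 = x.2⁻¹ * g.2 * y.2 := rfl
  rw [e1, e2]
  have hA : 0 ≤ 1 + κ g.1 := by linarith [κ_nonneg g.1]
  have hB : 0 ≤ 8 * κ x.1 * κ y.1 * (1 + κ (x.1⁻¹ * g.1 * y.1)) := by
    have := κ_nonneg x.1; have := κ_nonneg y.1; have := κ_nonneg (x.1⁻¹ * g.1 * y.1); positivity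
  calc (1 + κ g.1) * (1 + κ g.2)
      ≤ (8 * κ x.1 * κ y.1 * (1 + κ (x.1⁻¹ * g.1 * y.1))) * (8 * κ x.2 * κ y.2 * (1 + κ (x.2⁻¹ * g.2 * y.2))) :=
        mul_le_mul h1 h2 (by linarith [κ_nonneg g.2]) hB
    _ = M₂ x * M₂ y * ((1 + κ (x.1⁻¹ * g.1 * y.1)) * (1 + κ (x.2⁻¹ * g.2 * y.2))) := by
        simp only [M₂]; ring

/-- every element of `psize ≤ R` lies in a dyadic box `κ γ.1 ≤ 2^(k+1)`, `κ γ.2 ≤ (1 + R) / 2^k` with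
`k ≤ log₂ ⌊1 + R⌋₊` -/
theorem mem_dyadic_box {R : ℝ} (hR : 0 ≤ R) {g : G₂} (hg : psize g ≤ R) :
    ∃ k ∈ Finset.range (Nat.log 2 ⌊1 + R⌋₊ + 1),
      κ g.1 ≤ 2 ^ (k + 1) ∧ κ g.2 ≤ (1 + R) / 2 ^ k := by
  have hprod : (1 + κ g.1) * (1 + κ g.2) ≤ 1 + R := by rw [← one_add_psize]; linarith
  set t : ℝ := 1 + κ g.1 with ht
  have ht1 : 1 ≤ t := by have := κ_nonneg g.1; linarith
  have ht0 : 0 < t := by linarith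
  have hs1 : 1 ≤ 1 + κ g.2 := by have := κ_nonneg g.2; linarith
  have htR : t ≤ 1 + R := by nlinarith
  set k : ℕ := Nat.log 2 ⌊t⌋₊ with hk
  have h2k : (2 : ℝ) ^ k ≤ t := NumberFieldHyperbolicCount.two_pow_log_floor_le ht1
  have ht2k : t ≤ 2 ^ (k + 1) := NumberFieldHyperbolicCount.le_two_pow_log_floor_succ t
  have hkK : k ≤ Nat.log 2 ⌊1 + R⌋₊ := Nat.log_mono_right (Nat.floor_mono htR)
  refine ⟨k, Finset.mem_range.mpr (by omega), by linarith, ?_⟩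
  have h2kpos : (0 : ℝ) < 2 ^ k := by positivity
  have h1 : 1 + κ g.2 ≤ (1 + R) / t := by
    rw [le_div_iff₀ ht0]
    linarith [mul_comm t (1 + κ g.2)]
  have h2 : (1 + R) / t ≤ (1 + R) / 2 ^ k := div_le_div_of_nonneg_left (by linarith) h2kpos h2k
  linarith

/-- `(Nat.log 2 ⌊R⌋₊ : ℝ) ≤ logb 2 R` for `R ≥ 1` -/
theorem natLog_le_logb {R : ℝ} (hR : 1 ≤ R) : (Nat.log 2 ⌊R⌋₊ : ℝ) ≤ Real.logb 2 R := by
  rw [Real.le_logb_iff_rpow_le (by norm_num) (by linarith)]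
  have := NumberFieldHyperbolicCount.two_pow_log_floor_le hR
  rw [Real.rpow_natCast]
  exact this

open scoped Classical in
/-- THE DYADIC COUNT in the product size: `#{γ ∈ Γ : psize γ ≤ R} ≤ 2 (512/ε³)² (1 + R)(1 + log₂ (1 + R))` -/
theorem card_le_psize {Γ : Subgroup G₂} {ε₀ : ℝ} (hdisc : IsolatedOne₂ Γ ε₀) {ε : ℝ} (hε0 : 0 < ε)
    (hε : ε ≤ 1 / 8) (h6 : 6 * ε ≤ ε₀) {R : ℝ} (hR : 0 ≤ R) :
    ∃ t : Finset Γ, (∀ γ : Γ, psize (γ : G₂) ≤ R → γ ∈ t) ∧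
      (t.card : ℝ) ≤ 2 * (512 / ε ^ 3) ^ 2 * (1 + R) * (1 + Real.logb 2 (1 + R)) := by
  set K : ℕ := Nat.log 2 ⌊1 + R⌋₊ with hK
  -- the dyadic boxes
  have hbox : ∀ k : ℕ, {γ : Γ | κ (γ : G₂).1 ≤ 2 ^ (k + 1) ∧ κ (γ : G₂).2 ≤ (1 + R) / 2 ^ k}.Finite :=
    fun k => finite_box hdisc hε0 hε h6 (by positivity) (by positivity)
  refine ⟨(Finset.range (K + 1)).biUnion fun k => (hbox k).toFinset, fun γ hγ => ?_, ?_⟩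
  · obtain ⟨k, hk, h1, h2⟩ := mem_dyadic_box hR hγ
    exact Finset.mem_biUnion.mpr ⟨k, hk, (hbox k).mem_toFinset.mpr ⟨h1, h2⟩⟩
  · -- each box has `≤ 2 (512/ε³)² (1 + R)` elements
    have hcard : ∀ k ∈ Finset.range (K + 1),
        (((hbox k).toFinset.card : ℕ) : ℝ) ≤ 2 * (512 / ε ^ 3) ^ 2 * (1 + R) := by
      intro k _
      have h := card_le_box hdisc hε0 hε h6 (R₂ := 2 ^ (k + 1)) (R₃ := (1 + R) / 2 ^ k) (by positivity)
        (by positivity) (hbox k).toFinset fun γ hγ => (hbox k).mem_toFinset.mp hγ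
      refine h.trans (le_of_eq ?_)
      have h2k : (2 : ℝ) ^ k ≠ 0 := by positivity
      field_simp
      ring
    -- the number of boxes is `K + 1 ≤ 1 + logb 2 (1 + R)`
    have hK1 : ((K + 1 : ℕ) : ℝ) ≤ 1 + Real.logb 2 (1 + R) := by
      push_cast
      have := natLog_le_logb (R := 1 + R) (by linarith)
      linarith
    have hsum := Finset.card_biUnion_le (s := Finset.range (K + 1)) (t := fun k => (hbox k).toFinset)
    calc (((Finset.range (K + 1)).biUnion fun k => (hbox k).toFinset).card : ℝ)
        ≤ ∑ k ∈ Finset.range (K + 1), (((hbox k).toFinset.card : ℕ) : ℝ) := by exact_mod_cast hsum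
      _ ≤ ∑ _k ∈ Finset.range (K + 1), 2 * (512 / ε ^ 3) ^ 2 * (1 + R) := Finset.sum_le_sum hcard
      _ = ((K + 1 : ℕ) : ℝ) * (2 * (512 / ε ^ 3) ^ 2 * (1 + R)) := by
          rw [Finset.sum_const, Finset.card_range, nsmul_eq_mul]
      _ ≤ (1 + Real.logb 2 (1 + R)) * (2 * (512 / ε ^ 3) ^ 2 * (1 + R)) :=
          mul_le_mul_of_nonneg_right hK1 (by positivity)
      _ = 2 * (512 / ε ^ 3) ^ 2 * (1 + R) * (1 + Real.logb 2 (1 + R)) := by ring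

/-- `S (1 + logb 2 S) ≤ (1 + 1/(ε log 2)) (1 + S)^(1+ε)` for `S ≥ 1` (p5's `exists_finset_rpow` device) -/
theorem mul_one_add_logb_le {S ε : ℝ} (hS : 1 ≤ S) (hε : 0 < ε) :
    S * (1 + Real.logb 2 S) ≤ (1 + 1 / (ε * Real.log 2)) * (1 + S) ^ (1 + ε) := by
  have hlog2 : 0 < Real.log 2 := Real.log_pos (by norm_num)
  have hpos : 0 < ε * Real.log 2 := mul_pos hε hlog2
  have hS0 : 0 < S := by linarith
  have hlogb : Real.logb 2 S ≤ S ^ ε / (ε * Real.log 2) := by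
    have h := Real.log_le_rpow_div hS0.le hε
    rw [le_div_iff₀ hε] at h
    rw [Real.logb, div_le_div_iff₀ hlog2 hpos]
    nlinarith [hlog2]
  have hRe : S ^ (1 + ε) ≤ (1 + S) ^ (1 + ε) := Real.rpow_le_rpow hS0.le (by linarith) (by linarith)
  have hR1 : S ≤ (1 + S) ^ (1 + ε) := by
    calc S = S ^ (1 : ℝ) := (Real.rpow_one S).symm
      _ ≤ S ^ (1 + ε) := Real.rpow_le_rpow_of_exponent_le hS (by linarith)
      _ ≤ (1 + S) ^ (1 + ε) := hRe
  have hmul : S * S ^ ε = S ^ (1 + ε) := by rw [Real.rpow_add hS0, Real.rpow_one]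
  calc S * (1 + Real.logb 2 S) ≤ S * (1 + S ^ ε / (ε * Real.log 2)) := by
        apply mul_le_mul_of_nonneg_left _ hS0.le
        linarith
    _ = S + S ^ (1 + ε) / (ε * Real.log 2) := by rw [mul_add, mul_one, mul_div_assoc', hmul]
    _ ≤ (1 + S) ^ (1 + ε) + (1 + S) ^ (1 + ε) / (ε * Real.log 2) :=
        add_le_add hR1 (div_le_div_of_nonneg_right hRe hpos.le)
    _ = (1 + 1 / (ε * Real.log 2)) * (1 + S) ^ (1 + ε) := by ring

/-- **THE COUNT OF A DISCRETE SUBGROUP OF `SL(2,ℝ)²` IN THE PRODUCT SIZE, `β = 1 + ε'`** — the `hcount` shape of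
`PoincareKernel` for every `ε' > 0`: `∃ C', ∀ R ≥ 0, #{γ ∈ Γ : psize γ ≤ R} ≤ C' (1 + R)^(1+ε')`. -/
theorem count_psize_rpow (Γ : Subgroup G₂) {ε₀ : ℝ} (hε₀ : 0 < ε₀) (hdisc : IsolatedOne₂ Γ ε₀)
    {ε' : ℝ} (hε' : 0 < ε') :
    ∃ C' : ℝ, ∀ R : ℝ, 0 ≤ R → ∃ t : Finset Γ,
      (∀ γ : Γ, psize (γ : G₂) ≤ R → γ ∈ t) ∧ (t.card : ℝ) ≤ C' * (1 + R) ^ (1 + ε') := by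
  set ε : ℝ := min (1 / 8) (ε₀ / 8) with hεdef
  have hε0 : 0 < ε := lt_min (by norm_num) (by linarith)
  have hε1 : ε ≤ 1 / 8 := min_le_left _ _
  have h6 : 6 * ε ≤ ε₀ := by have := min_le_right (1 / 8 : ℝ) (ε₀ / 8); linarith
  refine ⟨2 * (512 / ε ^ 3) ^ 2 * (1 + 1 / (ε' * Real.log 2)) * 2 ^ (1 + ε'), fun R hR => ?_⟩
  obtain ⟨t, ht, hcard⟩ := card_le_psize hdisc hε0 hε1 h6 hR
  refine ⟨t, ht, hcard.trans ?_⟩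
  have h1 := mul_one_add_logb_le (S := 1 + R) (by linarith) hε'
  -- `(1 + (1 + R))^(1+ε') ≤ (2 (1 + R))^(1+ε') = 2^(1+ε') (1 + R)^(1+ε')`
  have h2 : (1 + (1 + R)) ^ (1 + ε') ≤ 2 ^ (1 + ε') * (1 + R) ^ (1 + ε') := by
    rw [← Real.mul_rpow (by norm_num) (by linarith)]
    exact Real.rpow_le_rpow (by linarith) (by linarith) (by linarith)
  have hC : 0 ≤ 2 * (512 / ε ^ 3) ^ 2 := by positivity
  have hD : 0 ≤ 1 + 1 / (ε' * Real.log 2) := by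
    have : 0 < Real.log 2 := Real.log_pos (by norm_num)
    positivity
  calc 2 * (512 / ε ^ 3) ^ 2 * (1 + R) * (1 + Real.logb 2 (1 + R))
      = 2 * (512 / ε ^ 3) ^ 2 * ((1 + R) * (1 + Real.logb 2 (1 + R))) := by ring
    _ ≤ 2 * (512 / ε ^ 3) ^ 2 * ((1 + 1 / (ε' * Real.log 2)) * (1 + (1 + R)) ^ (1 + ε')) :=
        mul_le_mul_of_nonneg_left h1 hC
    _ ≤ 2 * (512 / ε ^ 3) ^ 2 * ((1 + 1 / (ε' * Real.log 2)) * (2 ^ (1 + ε') * (1 + R) ^ (1 + ε'))) := by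
        gcongr
    _ = 2 * (512 / ε ^ 3) ^ 2 * (1 + 1 / (ε' * Real.log 2)) * 2 ^ (1 + ε') * (1 + R) ^ (1 + ε') := by ring

/-! ## 4. The Poincaré series on `SL(2,ℝ)²` of every discrete subgroup -/

variable (f : G₂ → ℂ)

/-- absolute convergence of the Poincaré series for a decay `(1 + psize g)^(−α)`, `α > 1` -/
theorem summable_norm_kernel_product (Γ : Subgroup G₂) {ε₀ : ℝ} (hε₀ : 0 < ε₀)
    (hdisc : IsolatedOne₂ Γ ε₀) {α : ℝ} (hα : 1 < α) {C : ℝ}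
    (hf : ∀ g, ‖f g‖ ≤ C * (1 + psize g) ^ (-α)) (x y : G₂) :
    Summable fun γ : Γ => ‖f (x⁻¹ * (γ : G₂) * y)‖ := by
  have hε' : 0 < (α - 1) / 2 := by linarith
  obtain ⟨C', hC'⟩ := count_psize_rpow Γ hε₀ hdisc hε'
  exact PoincareKernel.summable_norm_shift_of_mul psize (fun γ : Γ => (γ : G₂)) f psize_nonneg M₂_nonneg
    psize_shift (β := 1 + (α - 1) / 2) (by linarith) (by linarith) hC' hf x y

/-- **CONTINUITY OF THE POINCARÉ-SERIES KERNEL on `SL(2,ℝ)² × SL(2,ℝ)²`** of every discrete `Γ ≤ SL(2,ℝ)²` for a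
continuous `f` with the decay `(1 + psize g)^(−α)`, `α > 1` -/
theorem continuous_kernelSum_product (hfc : Continuous f) (Γ : Subgroup G₂) {ε₀ : ℝ} (hε₀ : 0 < ε₀)
    (hdisc : IsolatedOne₂ Γ ε₀) {α : ℝ} (hα : 1 < α) {C : ℝ}
    (hf : ∀ g, ‖f g‖ ≤ C * (1 + psize g) ^ (-α)) :
    Continuous (fun p : G₂ × G₂ => PoincareKernel.kernelSum (fun γ : Γ => (γ : G₂)) f p.1 p.2) := by
  have hε' : 0 < (α - 1) / 2 := by linarith
  obtain ⟨C', hC'⟩ := count_psize_rpow Γ hε₀ hdisc hε'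
  exact PoincareKernel.continuous_kernelSum_of_mul psize (fun γ : Γ => (γ : G₂)) f hfc M₂_nonneg M₂_locBdd
    psize_nonneg psize_shift (β := 1 + (α - 1) / 2) (by linarith) (by linarith) hC' hf

/-- the PRODUCT of two coefficients with the decay `(1 + κ)^(−α)` at each place has the decay `(1 + psize)^(−α)` -/
theorem norm_prod_le {f₂ f₃ : SL(2, ℝ) → ℂ} {C₂ C₃ α : ℝ}
    (h₂ : ∀ g, ‖f₂ g‖ ≤ C₂ * (1 + κ g) ^ (-α)) (h₃ : ∀ g, ‖f₃ g‖ ≤ C₃ * (1 + κ g) ^ (-α)) (g : G₂) :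
    ‖f₂ g.1 * f₃ g.2‖ ≤ (C₂ * C₃) * (1 + psize g) ^ (-α) := by
  have hp1 : 0 < 1 + κ g.1 := by linarith [κ_nonneg g.1]
  have hp2 : 0 < 1 + κ g.2 := by linarith [κ_nonneg g.2]
  have hC₂ : 0 ≤ C₂ := by
    have := h₂ g.1
    have hpos : 0 < (1 + κ g.1) ^ (-α) := Real.rpow_pos_of_pos hp1 _
    nlinarith [norm_nonneg (f₂ g.1)]
  rw [norm_mul, one_add_psize, Real.mul_rpow hp1.le hp2.le]
  calc ‖f₂ g.1‖ * ‖f₃ g.2‖ ≤ (C₂ * (1 + κ g.1) ^ (-α)) * (C₃ * (1 + κ g.2) ^ (-α)) :=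
        mul_le_mul (h₂ g.1) (h₃ g.2) (norm_nonneg _) (by positivity)
    _ = (C₂ * C₃) * ((1 + κ g.1) ^ (-α) * (1 + κ g.2) ^ (-α)) := by ring

/-- **THE LINE'S ARCHIMEDEAN KERNEL AT THE TWO `(1,1)`-PLACES**: for a discrete `Γ ≤ SL(2,ℝ)²` and two continuous
coefficients `f₂, f₃` with `‖f_j g‖ ≤ C_j (1 + κ g)^(−α)`, `α > 1` (weight `k`: `α = k/2`, `k ≥ 3`), the Poincaré series
`Σ_{γ ∈ Γ} f₂ (x₂⁻¹ γ₂ y₂) f₃ (x₃⁻¹ γ₃ y₃)` is continuous on `SL(2,ℝ)² × SL(2,ℝ)²`. -/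
theorem continuous_kernelSum_product_two (Γ : Subgroup G₂) {ε₀ : ℝ} (hε₀ : 0 < ε₀)
    (hdisc : IsolatedOne₂ Γ ε₀) {f₂ f₃ : SL(2, ℝ) → ℂ} (hc₂ : Continuous f₂) (hc₃ : Continuous f₃)
    {C₂ C₃ α : ℝ} (hα : 1 < α) (h₂ : ∀ g, ‖f₂ g‖ ≤ C₂ * (1 + κ g) ^ (-α))
    (h₃ : ∀ g, ‖f₃ g‖ ≤ C₃ * (1 + κ g) ^ (-α)) :
    Continuous (fun p : G₂ × G₂ =>
      PoincareKernel.kernelSum (fun γ : Γ => (γ : G₂)) (fun g : G₂ => f₂ g.1 * f₃ g.2) p.1 p.2) :=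
  continuous_kernelSum_product (fun g : G₂ => f₂ g.1 * f₃ g.2)
    ((hc₂.comp continuous_fst).mul (hc₃.comp continuous_snd)) Γ hε₀ hdisc hα
    (norm_prod_le h₂ h₃)
end

end Summit.Ventures.HodgeRepro2.Tier7.Line3.DiscreteProductCount
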